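import Summits.QuantumFields.YangMills.Theorems.AlphaInputsT3ACv3LinearLiftMatrixCLM
import HarnessLib

/-!
# `AlphaInputsT3ACv3LinearLiftMatrixCLMSub` — (V) THE MATRIX-VALUED PORT OF THE (LL) ENGINE, PART 8: the Newton pair `(T, R) = (avgCLM, liftSCLM)` RESTRICTED to the
# `S`-valued one-forms (`S` any `ℝ`-submodule of `M_n(ℂ)`, e.g. `𝔰𝔲(2)`) as continuous linear maps between COMPLETE subspaces — the Banach spaces `E`, `G` of ★w4's
# `…v3NewtonShell` when the unknown is an `𝔰𝔲(2)`-valued correction — with `T ∘ R = id`, the same operator-norm bounds and the curl row — cell `ym3-torus`, seat `ym-ust-19936-w3` (g0)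

WHY.  ★w4's shell `NewtonShell.exists_zero_in_range_of_approxRightInverse` is stated for complete normed spaces `E`, `G` over a field `𝕜`; the non-abelian candidates and their
defects are `𝔰𝔲(2)`-VALUED lattice one-forms, so the shell is applied with `E := ↥(piSub P S 0)`, `G := ↥(piSub P S k)` (the `S`-valued one-forms with the sup norm), which are
closed = complete (finite dimension).  Part 5 (`…LinearLiftMatrixCLM`) gave `avgCLM`∕`liftSCLM` on ALL matrix one-forms with `avgCLM_mem`∕`liftSCLM_mem`; THIS FILE restricts them:
`piSub P S j` (`mem_piSub`), `completeSpace_piSub`, ★ `avgCLMS`∕`liftSCLMS` (`ContinuousLinearMap.codRestrict ∘ Submodule.subtypeL`), `coe_avgCLMS`∕`coe_liftSCLMS`, ★★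
`avgCLMS_liftSCLMS : T (R u) = u` (`norm_avgCLMS_liftSCLMS_sub_le`: w4's `hR` with `κ = 0`), ★ `norm_avgCLMS_le` (`≤ (d+1)·L^k`), ★ `norm_liftSCLMS_le` (`≤ C_S∕L^k`), ★★
`norm_avgCLMS_mul_norm_liftSCLMS_le` (`≤ (d+1)·C_S`, k-UNIFORM), ★ `norm_curlM_liftSCLMS_le` (the curl row `p (R u) ≤ (4·18^d∕(L^k)²)·‖u‖`).
HONEST FRAMING.  Finite-dimensional real linear algebra; the nonlinear `Φ` of the shell is NOT here; nothing of [Balaban1985UV3]∕[Balaban1985Variational]∕[Balaban1985Averaging]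
is asserted; (FL)∕`hLift`, the stub 2′χ, the crux `HistoryTailL` and any gap are NOT claimed; count-neutral helper (`--supports stmt-QuantumFields-19936`); registry untouched.
YM₃ on the three-torus is a RUNG of the programme, not the Clay problem; nothing here is about d = 4, infinite volume or a mass gap.

References: T. Bałaban, Commun. Math. Phys. 109 (1987) 249–301 [Balaban1987RG1] ((0.4), (0.11) p.253); B. C. Hall, Lie Groups, Lie Algebras, and Representations (2015)
[Hall2015] (Example 7.3).
-/

set_option autoImplicit false

noncomputable section

open scoped Matrix.Norms.L2Operator

namespace Summit.QuantumFields.YangMills.Theorems.LinearLiftMatrix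

open Literature.MathematicalPhysics.QuantumFieldTheory.Balaban1983to89
open Literature.MathematicalPhysics.QuantumFieldTheory.Balaban1985CMP102.Setting
open Summit.QuantumFields.Balaban3D.Carriers

section Restricted

variable (P : Params) {n : Type*} [Fintype n] [DecidableEq n] (S : Submodule ℝ (Matrix n n ℂ))

/-- **THE `S`-VALUED ONE-FORMS ON `T^{(j)}`** as an `ℝ`-submodule of all matrix one-forms (e.g. `S = 𝔰𝔲(N)`). [cite: Hall2015, Example 7.3] -/
def piSub (j : ℕ) : Submodule ℝ (PBond P j → Matrix n n ℂ) := Submodule.pi Set.univ fun _ => S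

omit [Fintype n] [DecidableEq n] in
/-- Membership in `piSub`: every value lies in `S`. [cite: Hall2015, Example 7.3] -/
theorem mem_piSub {j : ℕ} {A : PBond P j → Matrix n n ℂ} : A ∈ piSub P S j ↔ ∀ c, A c ∈ S := by
  simp [piSub, Submodule.mem_pi]

/-- **THE `S`-VALUED ONE-FORMS ARE A COMPLETE (BANACH) SPACE** for the sup norm (finite dimension over `ℝ`). [folklore] -/
theorem completeSpace_piSub (j : ℕ) : CompleteSpace ↥(piSub P S j) := FiniteDimensional.complete ℝ _

variable (k : ℕ) (hk : k ≤ P.m + P.K)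

/-- **`T` RESTRICTED**: the `k`-fold matrix linearised average between the `S`-valued one-forms. [cite: Balaban1987RG1, (0.11) p.253] -/
def avgCLMS [Nonempty n] : ↥(piSub P S 0) →L[ℝ] ↥(piSub P S k) :=
  ((avgCLM P k).comp (piSub P S 0).subtypeL).codRestrict (piSub P S k) fun a =>
    (mem_piSub P S).2 fun c => avgCLM_mem k S ((mem_piSub P S).1 a.2) c

/-- **`R` RESTRICTED**: the sup-small exact matrix lift between the `S`-valued one-forms. [cite: Balaban1987RG1, (0.4)+(0.11) p.253] -/
def liftSCLMS : ↥(piSub P S k) →L[ℝ] ↥(piSub P S 0) :=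
  ((liftSCLM P k hk).comp (piSub P S k).subtypeL).codRestrict (piSub P S 0) fun u =>
    (mem_piSub P S).2 fun b => liftSCLM_mem k hk S ((mem_piSub P S).1 u.2) b

variable {P}

/-- The restricted `T` acts as `avgCLM` on the underlying one-form. [folklore] -/
@[simp] theorem coe_avgCLMS [Nonempty n] (a : ↥(piSub P S 0)) : ((avgCLMS P S k a : ↥(piSub P S k)) : PBond P k → Matrix n n ℂ) = avgCLM P k (a : PBond P 0 → Matrix n n ℂ) := rfl

/-- The restricted `R` acts as `liftSCLM` on the underlying one-form. [folklore] -/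
@[simp] theorem coe_liftSCLMS (u : ↥(piSub P S k)) : ((liftSCLMS P S k hk u : ↥(piSub P S 0)) : PBond P 0 → Matrix n n ℂ) = liftSCLM P k hk (u : PBond P k → Matrix n n ℂ) := rfl

/-- **★★ `T (R u) = u` ON THE `S`-VALUED ONE-FORMS.** [cite: Balaban1987RG1, (0.4)+(0.11) p.253] -/
theorem avgCLMS_liftSCLMS [Nonempty n] (u : ↥(piSub P S k)) : avgCLMS P S k (liftSCLMS P S k hk u) = u := by
  apply Subtype.ext
  rw [coe_avgCLMS, coe_liftSCLMS, avgCLM_liftSCLM k hk]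

/-- `T ∘L R = id` on the `S`-valued one-forms. [cite: Balaban1987RG1, (0.4)+(0.11) p.253] -/
theorem avgCLMS_comp_liftSCLMS [Nonempty n] : (avgCLMS P S k).comp (liftSCLMS P S k hk) = ContinuousLinearMap.id ℝ ↥(piSub P S k) := by
  ext1 u
  exact avgCLMS_liftSCLMS S k hk u

/-- **w4's `hR` WITH `κ = 0`** on the `S`-valued one-forms. [folklore] -/
theorem norm_avgCLMS_liftSCLMS_sub_le [Nonempty n] (u : ↥(piSub P S k)) : ‖avgCLMS P S k (liftSCLMS P S k hk u) - u‖ ≤ 0 * ‖u‖ := by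
  rw [avgCLMS_liftSCLMS S k hk, sub_self, norm_zero, zero_mul]

/-- **★ `‖T‖ ≤ (d+1)·L^k` on the `S`-valued one-forms.** [cite: Balaban1987RG1, (0.11) p.253] -/
theorem norm_avgCLMS_le [Nonempty n] : ‖(avgCLMS P S k : ↥(piSub P S 0) →L[ℝ] ↥(piSub P S k))‖ ≤ ((P.d : ℝ) + 1) * (P.L : ℝ) ^ k := by
  refine ContinuousLinearMap.opNorm_le_bound _ (by positivity) fun a => ?_
  show ‖avgCLM P k (a : PBond P 0 → Matrix n n ℂ)‖ ≤ (((P.d : ℝ) + 1) * (P.L : ℝ) ^ k) * ‖(a : PBond P 0 → Matrix n n ℂ)‖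
  refine (pi_norm_le_iff_of_nonneg (by positivity)).2 fun c => ?_
  rw [avgCLM_apply]
  exact norm_linAvgIterM_le k _ (fun b => norm_le_pi_norm (a : PBond P 0 → Matrix n n ℂ) b) c

/-- **★ `‖R‖ ≤ C_S ∕ L^k` on the `S`-valued one-forms.** [cite: Balaban1987RG1, (0.4)+(0.11) p.253] -/
theorem norm_liftSCLMS_le : ‖(liftSCLMS P S k hk : ↥(piSub P S k) →L[ℝ] ↥(piSub P S 0))‖ ≤ CS P / (P.L : ℝ) ^ k := by
  refine ContinuousLinearMap.opNorm_le_bound _ (div_nonneg (CS_nonneg P) (by positivity)) fun u => ?_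
  show ‖liftSCLM P k hk (u : PBond P k → Matrix n n ℂ)‖ ≤ (CS P / (P.L : ℝ) ^ k) * ‖(u : PBond P k → Matrix n n ℂ)‖
  refine (pi_norm_le_iff_of_nonneg (mul_nonneg (div_nonneg (CS_nonneg P) (by positivity)) (norm_nonneg _))).2 fun b => ?_
  rw [liftSCLM_apply]
  exact norm_liftSM_le k hk _ (fun c => norm_le_pi_norm (u : PBond P k → Matrix n n ℂ) c) b

/-- **★★ `‖T‖·‖R‖ ≤ (d+1)·C_S` — k-UNIFORM — on the `S`-valued one-forms.** [cite: Balaban1987RG1, (0.4)+(0.11) p.253] -/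
theorem norm_avgCLMS_mul_norm_liftSCLMS_le [Nonempty n] :
    ‖(avgCLMS P S k : ↥(piSub P S 0) →L[ℝ] ↥(piSub P S k))‖ * ‖(liftSCLMS P S k hk : ↥(piSub P S k) →L[ℝ] ↥(piSub P S 0))‖ ≤ ((P.d : ℝ) + 1) * CS P := by
  have hL : (0 : ℝ) < (P.L : ℝ) ^ k := by have := P.L_pos; positivity
  calc _ ≤ (((P.d : ℝ) + 1) * (P.L : ℝ) ^ k) * (CS P / (P.L : ℝ) ^ k) :=
        mul_le_mul (norm_avgCLMS_le S k) (norm_liftSCLMS_le S k hk) (ContinuousLinearMap.opNorm_nonneg _) (by positivity)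
    _ = ((P.d : ℝ) + 1) * CS P := by field_simp

/-- **★ THE CURL ROW ON THE `S`-VALUED ONE-FORMS**: `‖curlM (R u) x μ ν‖ ≤ (4·18^d∕(L^k)²)·‖u‖`. [cite: Balaban1987RG1, (0.4) p.253] -/
theorem norm_curlM_liftSCLMS_le (u : ↥(piSub P S k)) (x : Site P 0) {μ ν : Fin P.d} (hμν : μ ≠ ν) :
    ‖curlM ((liftSCLMS P S k hk u : ↥(piSub P S 0)) : PBond P 0 → Matrix n n ℂ) x μ ν‖ ≤ (4 * (18 : ℝ) ^ P.d / ((P.L : ℝ) ^ k) ^ 2) * ‖u‖ := by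
  rw [coe_liftSCLMS]
  exact norm_curlM_liftSCLM_le k hk _ x hμν

/-- Every value of `R u` lies in `S` (e.g. is skew-Hermitian traceless for `S = 𝔰𝔲(N)`). [cite: Hall2015, Example 7.3] -/
theorem liftSCLMS_apply_mem (u : ↥(piSub P S k)) (b : PBond P 0) : ((liftSCLMS P S k hk u : ↥(piSub P S 0)) : PBond P 0 → Matrix n n ℂ) b ∈ S :=
  (mem_piSub P S).1 (liftSCLMS P S k hk u).2 b

end Restricted

end Summit.QuantumFields.YangMills.Theorems.LinearLiftMatrix

end
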